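import Summits.Parity.GeneralizedHardyLittlewood.Theorems.ChenParityOracleBLAPHostParityFromBrickTypeISW
import Literature.NumberTheory.Sieve.BombieriFriedlanderIwaniecDispersionProofs
import Literature.NumberTheory.Sieve.DivisorPowerSums
import Mathlib.Algebra.Order.Chebyshev
import HarnessLib

/-!
# Route `ChenParityOracleBLAP` — crux S1 = `HostParityFromBrick` (stmt-Parity-20045): Barban–Davenport–Halberstam for `λ` on initial segments — block tools

Support file for the prime half `K1 → K2 → HP1` of S1 (the unconditional Type-I input, large
moduli).  From BFI's Theorem 0 (`BombieriFriedlanderIwaniecTheorem0a_classic`, the large sieve form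
of the Barban–Davenport–Halberstam theorem for sequences with (A₂)) and (A₂) for `λ`
(`siegelWalfiszHyp_liouville`), the mean square of the Liouville function in reduced classes over
INITIAL SEGMENTS:
`∑_{q ≤ Q} ∑_{(l,q)=1} |∑_{v ≤ V, v ≡ l (q)} λ(v)|² ≤ C X²/(log X)^A` for `X ≥ X₀`, `Q ≤ X^{3/4}`,
`V ≤ X` (`bdh_liouville_initial`): `[1, V]` is a union of `≤ 2 log X` dyadic blocks; blocks above
`X^{7/8}` by Theorem 0 plus the coprime mean `∑_{n ∼ N, (n,q)=1} λ(n)` (Möbius and the prime number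
theorem for `λ`, i.e. Siegel–Walfisz with `q = 1`), blocks below `X^{7/8}` trivially.

References: E. Bombieri, J. B. Friedlander, H. Iwaniec, Acta Math. 156 (1986), Theorem 0
[BombieriFriedlanderIwaniecActa1986]; H. L. Montgomery, R. C. Vaughan, *Multiplicative Number
Theory I* (2007), §17 [MontgomeryVaughan2007].
-/

namespace Summit.Parity.GeneralizedHardyLittlewood.Theorems

open Finset Real
open scoped ArithmeticFunction.sigma
open ArithmeticFunction (liouville)
open Literature.NumberTheory.Sieve Literature.NumberTheory.Sieve.BFI

/-! ### Dyadic decomposition of an initial segment -/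

/-- `[1, V] = ⋃_{j < J} (V/2^{j+1}, V/2^j]` as a sum identity, when `V < 2^J`. -/
theorem sum_Icc_eq_sum_dyadic_blocks {V J : ℕ} (hJ : V < 2 ^ J) (g : ℕ → ℝ) :
    ∑ v ∈ Icc 1 V, g v = ∑ j ∈ range J, ∑ v ∈ dyadic ((V : ℝ) / 2 ^ (j + 1)), g v := by
  classical
  have hV0 : (0 : ℝ) ≤ V := Nat.cast_nonneg _
  have hblock : ∀ j : ℕ, ∀ v : ℕ, v ∈ dyadic ((V : ℝ) / 2 ^ (j + 1)) ↔
      (V : ℝ) / 2 ^ (j + 1) < v ∧ (v : ℝ) ≤ (V : ℝ) / 2 ^ j := by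
    intro j v
    rw [mem_dyadic (by positivity)]
    rw [show 2 * ((V : ℝ) / 2 ^ (j + 1)) = (V : ℝ) / 2 ^ j by rw [pow_succ]; field_simp]
  -- disjointness
  have hdisj : ((range J : Finset ℕ) : Set ℕ).PairwiseDisjoint
      (fun j => dyadic ((V : ℝ) / 2 ^ (j + 1))) := by
    intro i _ j _ hij
    rw [Function.onFun, Finset.disjoint_left]
    intro v hvi hvj
    rw [hblock] at hvi hvj
    rcases lt_or_gt_of_ne hij with h | h
    · -- `i < j`: `V/2^j ≤ V/2^(i+1)`
      have : (V : ℝ) / 2 ^ j ≤ (V : ℝ) / 2 ^ (i + 1) :=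
        div_le_div_of_nonneg_left hV0 (by positivity) (pow_le_pow_right₀ (by norm_num) (by omega))
      linarith [hvi.1, hvj.2]
    · have : (V : ℝ) / 2 ^ i ≤ (V : ℝ) / 2 ^ (j + 1) :=
        div_le_div_of_nonneg_left hV0 (by positivity) (pow_le_pow_right₀ (by norm_num) (by omega))
      linarith [hvj.1, hvi.2]
  rw [← Finset.sum_biUnion hdisj]
  refine Finset.sum_congr ?_ fun _ _ => rfl
  ext v
  simp only [Finset.mem_Icc, Finset.mem_biUnion, Finset.mem_range]
  constructor
  · rintro ⟨hv1, hvV⟩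
    -- `j = log₂ ⌊V/v⌋`
    set j := Nat.log 2 (V / v) with hj
    have hv0 : 0 < v := by omega
    have hq1 : 1 ≤ V / v := (Nat.le_div_iff_mul_le hv0).mpr (by omega)
    have hpow : 2 ^ j ≤ V / v := Nat.pow_log_le_self 2 (by omega)
    have hlt : V / v < 2 ^ (j + 1) := Nat.lt_pow_succ_log_self (by norm_num) _
    refine ⟨j, ?_, ?_⟩
    · -- `2^j ≤ V/v ≤ V < 2^J`
      by_contra hcon
      push Not at hcon
      have : 2 ^ J ≤ 2 ^ j := Nat.pow_le_pow_right (by norm_num) hcon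
      have : V / v ≤ V := Nat.div_le_self _ _
      omega
    · rw [hblock]
      constructor
      · -- `V < 2^{j+1} v`
        have h1 : V < 2 ^ (j + 1) * v := (Nat.div_lt_iff_lt_mul hv0).mp hlt
        have h2 : (V : ℝ) < 2 ^ (j + 1) * v := by exact_mod_cast h1
        rw [div_lt_iff₀ (by positivity)]; linarith [mul_comm ((2:ℝ) ^ (j+1)) (v:ℝ)]
      · -- `2^j v ≤ V`
        have h1 : 2 ^ j * v ≤ V := by
          have := (Nat.le_div_iff_mul_le hv0).mp hpow; linarith
        have h2 : (2 : ℝ) ^ j * v ≤ V := by exact_mod_cast h1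
        rw [le_div_iff₀ (by positivity)]; linarith [mul_comm ((2:ℝ) ^ j) (v:ℝ)]
  · rintro ⟨j, _, hv⟩
    rw [hblock] at hv
    obtain ⟨h1, h2⟩ := hv
    constructor
    · have : (0 : ℝ) < v := lt_of_le_of_lt (by positivity) h1
      exact_mod_cast this
    · have : (v : ℝ) ≤ V := h2.trans (div_le_self hV0 (one_le_pow₀ (by norm_num)))
      exact_mod_cast this


/-! ### The coprime mean of `λ` on a dyadic block -/

/-- **The coprime mean** `∑_{n ∼ N, (n,q)=1} λ(n)` is small: for every `B > 0` there is `Cm ≥ 0`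
with `|∑_{n ∼ N, (n,q)=1} λ(n)| ≤ Cm τ(q) (N/(log N)^B + √N)` for all `N ≥ 9`, `q ≥ 1` (Möbius over
`e ∣ q`; the prime number theorem for `λ` in the form of Siegel–Walfisz with modulus `1` for
`e ≤ √N`, trivially for `e > √N`). -/
theorem abs_coprime_mean_liouville_le (B : ℝ) (hB : 0 < B) :
    ∃ Cm : ℝ, 0 ≤ Cm ∧ ∀ N : ℝ, 9 ≤ N → ∀ q : ℕ, 1 ≤ q →
      |∑ n ∈ (dyadic N).filter (fun n : ℕ => n.Coprime q), (liouville n : ℝ)| ≤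
        Cm * (σ 0 q : ℝ) * (N / Real.log N ^ B + Real.sqrt N) := by
  classical
  obtain ⟨C₁, hC₁⟩ := Literature.NumberTheory.LFunctions.SiegelWalfiszMoebius_holds.liouville_progression
    (A := 1) one_pos B
  set C := max C₁ 0 with hC
  refine ⟨3 * C * 2 ^ B + 3, by positivity, fun N hN q hq => ?_⟩
  have hN0 : 0 ≤ N := by linarith
  have hq0 : q ≠ 0 := by omega
  have hsqrt3 : 3 ≤ Real.sqrt N := by
    rw [show (3 : ℝ) = Real.sqrt 9 by rw [show (9:ℝ) = 3^2 by norm_num, Real.sqrt_sq (by norm_num)]]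
    exact Real.sqrt_le_sqrt hN
  have hlogN : 0 < Real.log N := Real.log_pos (by linarith)
  -- Möbius over `e ∣ q`
  rw [Polymath8a.sum_filter_coprime_eq_sum_divisors_moebius _ _ hq0]
  -- each `e`-term
  have hterm : ∀ e ∈ q.divisors, |(ArithmeticFunction.moebius e : ℝ) *
      ∑ n ∈ (dyadic N).filter (fun n => e ∣ n), (liouville n : ℝ)| ≤
      3 * C * 2 ^ B * (N / Real.log N ^ B) + 3 * Real.sqrt N := by
    intro e he
    have he1 : 1 ≤ e := Nat.pos_of_mem_divisors he
    have he0 : (0 : ℝ) < e := by exact_mod_cast he1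
    have hμ : |(ArithmeticFunction.moebius e : ℝ)| ≤ 1 := by exact_mod_cast ArithmeticFunction.abs_moebius_le_one
    -- `∑_{n ∼ N, e ∣ n} λ(n) = λ(e) ∑_{m ∼ N/e} λ(m)`, a class sum modulo `1`
    have hre : ∑ n ∈ (dyadic N).filter (fun n => e ∣ n), (liouville n : ℝ) =
        (liouville e : ℝ) * ∑ m ∈ (dyadic (N / e)).filter (fun m : ℕ => (m : ZMod 1) = 0), (liouville m : ℝ) := by
      have h1 : (dyadic N).filter (fun n => e ∣ n) = (dyadic N).filter (fun n => e ∣ n ∧ True) := by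
        simp
      rw [h1, sum_dyadic_filter_dvd_eq hN0 he1 (fun _ => True), Finset.mul_sum]
      refine Finset.sum_congr ?_ fun m _ => by rw [ArithmeticFunction.liouville_apply_mul]; push_cast; ring
      ext m; simp [Subsingleton.elim (m : ZMod 1) 0]
    have hle2 : |(liouville e : ℝ)| ≤ 1 := Literature.NumberTheory.LFunctions.LiouvilleSum.abs_liouville_le_one e
    have hinner : |∑ m ∈ (dyadic (N / e)).filter (fun m : ℕ => (m : ZMod 1) = 0), (liouville m : ℝ)| ≤
        3 * C * 2 ^ B * (N / Real.log N ^ B) + 3 * Real.sqrt N := by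
      have hM0 : 0 ≤ N / e := by positivity
      by_cases hes : (e : ℝ) ≤ Real.sqrt N
      · have hMge : Real.sqrt N ≤ N / e := by
          rw [le_div_iff₀ he0]
          calc Real.sqrt N * e ≤ Real.sqrt N * Real.sqrt N := mul_le_mul_of_nonneg_left hes (Real.sqrt_nonneg _)
            _ = N := Real.mul_self_sqrt hN0
        have hM3 : 3 ≤ N / e := hsqrt3.trans hMge
        have hlogM : Real.log N / 2 ≤ Real.log (N / e) := by
          have h1 : Real.log (Real.sqrt N) = Real.log N / 2 := by
            rw [Real.sqrt_eq_rpow, Real.log_rpow (by linarith)]; ring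
          rw [← h1]; exact Real.log_le_log (by linarith) hMge
        have hR : ∀ y : ℝ, N / e ≤ y → y ≤ 2 * (N / e) →
            |∑ m ∈ (Icc 1 ⌊y⌋₊).filter (fun m : ℕ => (m : ZMod 1) = 0), (liouville m : ℝ)| ≤
              C * 2 ^ B * y / Real.log N ^ B := by
          intro y hy hy2
          have hy3 : 3 ≤ y := hM3.trans hy
          have hlogy : 1 ≤ Real.log y := by
            rw [Real.le_log_iff_exp_le (by linarith)]
            linarith [Real.exp_one_lt_d9]
          have h1 := hC₁ y (by linarith) 1 le_rfl (by rw [Nat.cast_one, Real.rpow_one]; exact hlogy) 0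
          have hly : Real.log N / 2 ≤ Real.log y := hlogM.trans (Real.log_le_log (by linarith) hy)
          have hlypos : 0 < Real.log y := by linarith
          calc _ ≤ C₁ * y / Real.log y ^ B := h1
            _ ≤ C * y / Real.log y ^ B := by gcongr; exact le_max_left _ _
            _ ≤ C * y / (Real.log N / 2) ^ B := by
                refine div_le_div_of_nonneg_left (by positivity) (Real.rpow_pos_of_pos (by linarith) _) ?_
                exact Real.rpow_le_rpow (by linarith) hly hB.le
            _ = C * 2 ^ B * y / Real.log N ^ B := by
                rw [Real.div_rpow hlogN.le (by norm_num)]; field_simp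
        calc _ ≤ |∑ m ∈ (Icc 1 ⌊2 * (N / e)⌋₊).filter (fun m : ℕ => (m : ZMod 1) = 0), (liouville m : ℝ)| +
              |∑ m ∈ (Icc 1 ⌊N / e⌋₊).filter (fun m : ℕ => (m : ZMod 1) = 0), (liouville m : ℝ)| :=
              abs_sum_dyadic_class_le hM0 1 0
          _ ≤ C * 2 ^ B * (2 * (N / e)) / Real.log N ^ B + C * 2 ^ B * (N / e) / Real.log N ^ B :=
              add_le_add (hR _ (by linarith) le_rfl) (hR _ le_rfl (by linarith))
          _ = 3 * C * 2 ^ B * ((N / e) / Real.log N ^ B) := by ring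
          _ ≤ 3 * C * 2 ^ B * (N / Real.log N ^ B) := by
              refine mul_le_mul_of_nonneg_left ?_ (by positivity)
              exact div_le_div_of_nonneg_right (div_le_self hN0 (by exact_mod_cast he1))
                (Real.rpow_nonneg hlogN.le _)
          _ ≤ _ := by linarith [Real.sqrt_nonneg N]
      · push Not at hes
        have hMle : N / e ≤ Real.sqrt N := by
          rw [div_le_iff₀ he0]
          calc N = Real.sqrt N * Real.sqrt N := (Real.mul_self_sqrt hN0).symm
            _ ≤ Real.sqrt N * e := mul_le_mul_of_nonneg_left hes.le (Real.sqrt_nonneg _)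
        calc _ ≤ ∑ m ∈ (dyadic (N / e)).filter (fun m : ℕ => (m : ZMod 1) = 0), |(liouville m : ℝ)| :=
              Finset.abs_sum_le_sum_abs _ _
          _ ≤ ∑ m ∈ dyadic (N / e), |(liouville m : ℝ)| :=
              Finset.sum_le_sum_of_subset_of_nonneg (Finset.filter_subset _ _) fun _ _ _ => abs_nonneg _
          _ ≤ ∑ _m ∈ dyadic (N / e), (1 : ℝ) := Finset.sum_le_sum fun m _ =>
              Literature.NumberTheory.LFunctions.LiouvilleSum.abs_liouville_le_one m
          _ = #(dyadic (N / e)) := by simp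
          _ ≤ 2 * (N / e) + 1 := card_dyadic_le hM0
          _ ≤ 3 * Real.sqrt N := by linarith
          _ ≤ _ := by
              have : 0 ≤ 3 * C * 2 ^ B * (N / Real.log N ^ B) := by positivity
              linarith
    rw [hre, abs_mul, abs_mul]
    calc |(ArithmeticFunction.moebius e : ℝ)| * (|(liouville e : ℝ)| *
          |∑ m ∈ (dyadic (N / e)).filter (fun m : ℕ => (m : ZMod 1) = 0), (liouville m : ℝ)|)
        ≤ 1 * (1 * (3 * C * 2 ^ B * (N / Real.log N ^ B) + 3 * Real.sqrt N)) := by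
          apply mul_le_mul hμ (mul_le_mul hle2 hinner (abs_nonneg _) zero_le_one) (by positivity)
            zero_le_one
      _ = _ := by ring
  calc _ ≤ ∑ e ∈ q.divisors, |(ArithmeticFunction.moebius e : ℝ) *
        ∑ n ∈ (dyadic N).filter (fun n => e ∣ n), (liouville n : ℝ)| := Finset.abs_sum_le_sum_abs _ _
    _ ≤ ∑ _e ∈ q.divisors, (3 * C * 2 ^ B * (N / Real.log N ^ B) + 3 * Real.sqrt N) :=
        Finset.sum_le_sum hterm
    _ = (σ 0 q : ℝ) * (3 * C * 2 ^ B * (N / Real.log N ^ B) + 3 * Real.sqrt N) := by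
        rw [Finset.sum_const, nsmul_eq_mul, ArithmeticFunction.sigma_zero_apply]
    _ ≤ (3 * C * 2 ^ B + 3) * (σ 0 q : ℝ) * (N / Real.log N ^ B + Real.sqrt N) := by
        have h1 : (0 : ℝ) ≤ (σ 0 q : ℝ) := Nat.cast_nonneg _
        have h2 : 0 ≤ N / Real.log N ^ B := by positivity
        have h3 : 0 ≤ Real.sqrt N := Real.sqrt_nonneg _
        have h4 : (0 : ℝ) ≤ 3 * C * 2 ^ B := by positivity
        nlinarith [mul_nonneg h1 h2, mul_nonneg h1 h3, mul_nonneg h4 (mul_nonneg h1 h3),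
          mul_nonneg h1 h2]

/-! ### The trivial bound for one block -/

/-- Trivially, `∑_{q ≤ Q} ∑_{(l,q)=1} (∑_{n ∼ N, n ≡ l (q)} λ(n))² ≤ 8N²(log Q + 1) + 2Q²`
(`#{n ∼ N : n ≡ l} ≤ 2N/q + 1`). -/
theorem sum_sq_dyadic_class_trivial {N : ℝ} (hN : 0 ≤ N) (Q : ℕ) :
    ∑ q ∈ Icc 1 Q, ∑ l ∈ (range q).filter (fun l => l.Coprime q),
      (∑ n ∈ dyadic N, if (n : ZMod q) = (l : ZMod q) then (liouville n : ℝ) else 0) ^ 2 ≤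
      8 * N ^ 2 * (Real.log Q + 1) + 2 * (Q : ℝ) ^ 2 := by
  have hq : ∀ q ∈ Icc 1 Q, ∑ l ∈ (range q).filter (fun l => l.Coprime q),
      (∑ n ∈ dyadic N, if (n : ZMod q) = (l : ZMod q) then (liouville n : ℝ) else 0) ^ 2 ≤
      8 * N ^ 2 / q + 2 * q := by
    intro q hq
    have hq1 : 1 ≤ q := (Finset.mem_Icc.mp hq).1
    have hq0 : (0 : ℝ) < q := by exact_mod_cast hq1
    haveI : NeZero q := ⟨by omega⟩
    have hl : ∀ l ∈ (range q).filter (fun l => l.Coprime q),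
        (∑ n ∈ dyadic N, if (n : ZMod q) = (l : ZMod q) then (liouville n : ℝ) else 0) ^ 2 ≤
        (2 * N / q + 1) ^ 2 := by
      intro l hl
      rw [Finset.mem_filter] at hl
      have hlu : IsUnit ((l : ℕ) : ZMod q) := (ZMod.isUnit_iff_coprime l q).mpr hl.2
      have hcard := card_dyadic_filter_class_le hN hq1 hlu
      have habs : |∑ n ∈ dyadic N, if (n : ZMod q) = (l : ZMod q) then (liouville n : ℝ) else 0| ≤
          2 * N / q + 1 := by
        rw [← Finset.sum_filter]
        calc _ ≤ ∑ n ∈ (dyadic N).filter (fun n : ℕ => (n : ZMod q) = (l : ZMod q)), |(liouville n : ℝ)| :=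
              Finset.abs_sum_le_sum_abs _ _
          _ ≤ ∑ _n ∈ (dyadic N).filter (fun n : ℕ => (n : ZMod q) = (l : ZMod q)), (1 : ℝ) :=
              Finset.sum_le_sum fun n _ => Literature.NumberTheory.LFunctions.LiouvilleSum.abs_liouville_le_one n
          _ = #((dyadic N).filter (fun n : ℕ => (n : ZMod q) = (l : ZMod q))) := by simp
          _ ≤ 2 * N / q + 1 := by exact_mod_cast hcard
      have h0 : 0 ≤ 2 * N / q + 1 := by positivity
      calc _ = |∑ n ∈ dyadic N, if (n : ZMod q) = (l : ZMod q) then (liouville n : ℝ) else 0| ^ 2 :=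
            (sq_abs _).symm
        _ ≤ (2 * N / q + 1) ^ 2 := pow_le_pow_left₀ (abs_nonneg _) habs 2
    have hcardl : (#((range q).filter (fun l => l.Coprime q)) : ℝ) ≤ q := by
      have : #((range q).filter (fun l => l.Coprime q)) ≤ #(range q) := Finset.card_filter_le _ _
      rw [Finset.card_range] at this; exact_mod_cast this
    calc _ ≤ ∑ _l ∈ (range q).filter (fun l => l.Coprime q), (2 * N / q + 1) ^ 2 := Finset.sum_le_sum hl
      _ = #((range q).filter (fun l => l.Coprime q)) * (2 * N / q + 1) ^ 2 := by
          rw [Finset.sum_const, nsmul_eq_mul]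
      _ ≤ q * (2 * N / q + 1) ^ 2 := mul_le_mul_of_nonneg_right hcardl (sq_nonneg _)
      _ ≤ q * (2 * (2 * N / q) ^ 2 + 2) := by
          refine mul_le_mul_of_nonneg_left ?_ hq0.le
          nlinarith [sq_nonneg (2 * N / q - 1)]
      _ = 8 * N ^ 2 / q + 2 * q := by field_simp; ring
  calc _ ≤ ∑ q ∈ Icc 1 Q, (8 * N ^ 2 / q + 2 * q) := Finset.sum_le_sum hq
    _ = 8 * N ^ 2 * ∑ q ∈ Icc 1 Q, (1 : ℝ) / q + 2 * ∑ q ∈ Icc 1 Q, (q : ℝ) := by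
        have h1 : ∑ q ∈ Icc 1 Q, 8 * N ^ 2 / (q : ℝ) = 8 * N ^ 2 * ∑ q ∈ Icc 1 Q, (1 : ℝ) / q := by
          rw [Finset.mul_sum]; exact Finset.sum_congr rfl fun q _ => by ring
        have h2 : ∑ q ∈ Icc 1 Q, 2 * (q : ℝ) = 2 * ∑ q ∈ Icc 1 Q, (q : ℝ) := by rw [Finset.mul_sum]
        rw [Finset.sum_add_distrib, h1, h2]
    _ ≤ 8 * N ^ 2 * (Real.log Q + 1) + 2 * ((Q : ℝ) * Q) := by
        gcongr
        · calc ∑ q ∈ Icc 1 Q, (1 : ℝ) / q = ∑ q ∈ Icc 1 Q, ((q : ℝ))⁻¹ := by simp [one_div]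
            _ ≤ 1 + Real.log Q := by
                have := harmonic_le_one_add_log Q
                rw [harmonic_eq_sum_Icc] at this; push_cast at this; exact this
            _ = Real.log Q + 1 := by ring
        · calc ∑ q ∈ Icc 1 Q, (q : ℝ) ≤ ∑ _q ∈ Icc 1 Q, (Q : ℝ) :=
              Finset.sum_le_sum fun q hq => by exact_mod_cast (Finset.mem_Icc.mp hq).2
            _ = (Q : ℝ) * Q := by rw [Finset.sum_const, Nat.card_Icc, nsmul_eq_mul]; push_cast; ring
    _ = _ := by ring


/-! ### One large block: Theorem 0 plus the coprime mean -/

/-- `#{l < q : (l, q) = 1} = φ(q)`. -/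
theorem card_filter_coprime_eq_totient (q : ℕ) :
    #((range q).filter (fun l => l.Coprime q)) = Nat.totient q := by
  rw [Nat.totient_eq_card_coprime]
  congr 1
  exact Finset.filter_congr fun l _ => by rw [Nat.coprime_comm]

/-- **One large block.**  If `β = λ` satisfies the conclusion of BFI's Theorem 0 at scale `N`
(discrepancies, constant `C₀`, saving `A'`) and the coprime means obey
`|∑_{n ∼ N, (n,q)=1} λ(n)| ≤ W τ(q)` for `q ≤ Q`, then
`∑_{q ≤ Q} ∑_{(l,q)=1} (∑_{n ∼ N, n ≡ l (q)} λ(n))² ≤ 2 C₀ ‖λ‖² N/(log N)^{A'} + 2 W² ∑_{q ≤ Q} τ(q)²/φ(q)`. -/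
theorem sum_sq_dyadic_class_large {N C₀ A' W : ℝ} {Q : ℕ}
    (h0a : ∑ q ∈ Icc 1 Q, ∑ l ∈ (range q).filter (fun l => l.Coprime q),
      ((∑ n ∈ dyadic N, if (n : ZMod q) = (l : ZMod q) then (liouville n : ℝ) else 0) -
        (∑ n ∈ dyadic N, if n.Coprime q then (liouville n : ℝ) else 0) / (Nat.totient q : ℝ)) ^ 2 ≤
      C₀ * l2Sq N (fun n => (liouville n : ℝ)) * N / Real.log N ^ A')
    (hmean : ∀ q ∈ Icc 1 Q, |∑ n ∈ dyadic N, if n.Coprime q then (liouville n : ℝ) else 0| ≤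
      W * (σ 0 q : ℝ)) :
    ∑ q ∈ Icc 1 Q, ∑ l ∈ (range q).filter (fun l => l.Coprime q),
      (∑ n ∈ dyadic N, if (n : ZMod q) = (l : ZMod q) then (liouville n : ℝ) else 0) ^ 2 ≤
      2 * (C₀ * l2Sq N (fun n => (liouville n : ℝ)) * N / Real.log N ^ A') +
        2 * W ^ 2 * ∑ q ∈ Icc 1 Q, (σ 0 q : ℝ) ^ 2 / (Nat.totient q : ℝ) := by
  have hq : ∀ q ∈ Icc 1 Q, ∑ l ∈ (range q).filter (fun l => l.Coprime q),
      (∑ n ∈ dyadic N, if (n : ZMod q) = (l : ZMod q) then (liouville n : ℝ) else 0) ^ 2 ≤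
      2 * ∑ l ∈ (range q).filter (fun l => l.Coprime q),
        ((∑ n ∈ dyadic N, if (n : ZMod q) = (l : ZMod q) then (liouville n : ℝ) else 0) -
          (∑ n ∈ dyadic N, if n.Coprime q then (liouville n : ℝ) else 0) / (Nat.totient q : ℝ)) ^ 2 +
      2 * W ^ 2 * ((σ 0 q : ℝ) ^ 2 / (Nat.totient q : ℝ)) := by
    intro q hq'
    have hq1 : 1 ≤ q := (Finset.mem_Icc.mp hq').1
    have hφ : (0 : ℝ) < Nat.totient q := by exact_mod_cast Nat.totient_pos.mpr hq1
    set M := ∑ n ∈ dyadic N, if n.Coprime q then (liouville n : ℝ) else 0 with hM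
    have hM2 : M ^ 2 ≤ (W * (σ 0 q : ℝ)) ^ 2 := by
      rw [← sq_abs M]; exact pow_le_pow_left₀ (abs_nonneg _) (hmean q hq') 2
    have hpt : ∀ l ∈ (range q).filter (fun l => l.Coprime q),
        (∑ n ∈ dyadic N, if (n : ZMod q) = (l : ZMod q) then (liouville n : ℝ) else 0) ^ 2 ≤
        2 * ((∑ n ∈ dyadic N, if (n : ZMod q) = (l : ZMod q) then (liouville n : ℝ) else 0) -
            M / (Nat.totient q : ℝ)) ^ 2 + 2 * (M / (Nat.totient q : ℝ)) ^ 2 := by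
      intro l _
      nlinarith [sq_nonneg ((∑ n ∈ dyadic N, if (n : ZMod q) = (l : ZMod q) then (liouville n : ℝ) else 0) -
        2 * (M / (Nat.totient q : ℝ)))]
    refine (Finset.sum_le_sum hpt).trans ?_
    rw [Finset.sum_add_distrib, ← Finset.mul_sum, Finset.sum_const, card_filter_coprime_eq_totient,
      nsmul_eq_mul]
    refine add_le_add le_rfl ?_
    -- `φ(q) · 2 (M/φ)² = 2 M²/φ ≤ 2 W² τ² / φ`
    rw [show (Nat.totient q : ℝ) * (2 * (M / (Nat.totient q : ℝ)) ^ 2) = 2 * (M ^ 2 / (Nat.totient q : ℝ)) by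
      field_simp]
    rw [show 2 * W ^ 2 * ((σ 0 q : ℝ) ^ 2 / (Nat.totient q : ℝ)) = 2 * ((W * (σ 0 q : ℝ)) ^ 2 / (Nat.totient q : ℝ)) by
      ring]
    exact mul_le_mul_of_nonneg_left (div_le_div_of_nonneg_right hM2 hφ.le) (by norm_num)
  refine (Finset.sum_le_sum hq).trans ?_
  rw [Finset.sum_add_distrib, ← Finset.mul_sum, ← Finset.mul_sum]
  exact add_le_add (mul_le_mul_of_nonneg_left h0a (by norm_num)) le_rfl


/-! ### Sums of the block sizes -/

/-- `∑_{j<J} (V/2^{j+1})² ≤ V²/3` and `∑_{j<J} V/2^{j+1} ≤ V`. -/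
theorem sum_blocks_le (V : ℝ) (hV : 0 ≤ V) (J : ℕ) :
    ∑ j ∈ range J, (V / 2 ^ (j + 1)) ^ 2 ≤ V ^ 2 / 3 ∧ ∑ j ∈ range J, V / 2 ^ (j + 1) ≤ V := by
  constructor
  · have h : ∀ j : ℕ, (V / 2 ^ (j + 1)) ^ 2 = V ^ 2 / 4 * (1 / 4) ^ j := by
      intro j
      have h4 : (2 : ℝ) ^ (j + 1) = 2 * 2 ^ j := by rw [pow_succ]; ring
      have h44 : ((2 : ℝ) ^ j) ^ 2 = 4 ^ j := by rw [← pow_mul, mul_comm, pow_mul]; norm_num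
      rw [div_pow, h4, mul_pow, h44, one_div_pow]
      field_simp
      norm_num
    simp_rw [h, ← Finset.mul_sum]
    have hg : ∑ j ∈ range J, ((1 : ℝ) / 4) ^ j ≤ 4 / 3 := by
      have := geom_sum_Ico_le_of_lt_one (x := (1:ℝ)/4) (m := 0) (n := J) (by norm_num) (by norm_num)
      simp only [pow_zero] at this
      rw [Finset.range_eq_Ico]
      exact this.trans (by norm_num)
    calc V ^ 2 / 4 * ∑ j ∈ range J, ((1 : ℝ) / 4) ^ j ≤ V ^ 2 / 4 * (4 / 3) :=
          mul_le_mul_of_nonneg_left hg (by positivity)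
      _ = V ^ 2 / 3 := by ring
  · have h : ∀ j : ℕ, V / 2 ^ (j + 1) = V / 2 * (1 / 2) ^ j := by
      intro j; rw [pow_succ, one_div_pow]; field_simp
    simp_rw [h, ← Finset.mul_sum]
    have hg : ∑ j ∈ range J, ((1 : ℝ) / 2) ^ j ≤ 2 := by
      have := geom_sum_Ico_le_of_lt_one (x := (1:ℝ)/2) (m := 0) (n := J) (by norm_num) (by norm_num)
      simp only [pow_zero] at this
      rw [Finset.range_eq_Ico]
      exact this.trans (by norm_num)
    calc V / 2 * ∑ j ∈ range J, ((1 : ℝ) / 2) ^ j ≤ V / 2 * 2 := mul_le_mul_of_nonneg_left hg (by positivity)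
      _ = V := by ring

end Summit.Parity.GeneralizedHardyLittlewood.Theorems
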